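import Literature.NumberTheory.Sieve.PolymathGEHRoughTuples
import HarnessLib

/-!
# The main term of the truncated inner sum (§4.5, p. 18, (cpeps))

Trunk AntSieve, tooling toward the named fact `Literature.NumberTheory.Sieve.weakDHL_three_two_of_GEH`
(D. H. J. Polymath, Res. Math. Sci. 1:12 (2014) = arXiv:1407.4897, Theorem 3.2(xii)).

§4.5, p. 18: "a standard application of Mertens' theorem and the prime number theorem (and an
induction on `r`) shows that … `Σ_{x^ε ≤ p_1 < … < p_r : x+h_k ≤ p_1⋯p_r ≤ 2x+h_k} f(log_x p_1, …, log_x p_r)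
= (c_f + o(1)) x/log x` … we obtain an asymptotic (cpeps) with `c''_ε := Σ_{1 ≤ r ≤ 1/ε+1} ∫ …`."
We use the Ford–Maynard prime-tuple comparison `FordMaynard.exists_primeTupleSum_approx` (tree) in
place of the induction on `r`, with base `X₂` and the test function
`G(y) = 1_U(y) (∂_{(c y)}F(0))²`, `c = log X₂ / log x`, rescale the comparison integral to the
variables `u = log p / log x` (`integral_comp_smul`), and identify it with
`r! ∫_{ℓ₁}^{ℓ₂} x^t Mfun ε (r-1) t F dt` (`PolymathGEHRoughSlices.lean`).  Main results:

* `sum_roughSqfree_isLittleO` — `Σ_{m ∈ roughSqfree r} λ_F(m)² = (Mfun ε (r-1) 1 F + o(1)) x/log x`;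
* `innerTotal_wTrunc_sub_isLittleO` — the truncated inner sum
  `Σ_{X₁ < m ≤ X₂} λ_F(m) λ_G(m) 1_{p(m) > x^ε} = (c''_ε(F,G) + o(1)) x/log x` with
  `c''_ε(F,G) = Depol.cdeps ε (⌊1/ε⌋+1) F G`.

## References

* [Polymath8b2014] D. H. J. Polymath, Res. Math. Sci. 1 (2014), Art. 12 = arXiv:1407.4897,
  §4.5, p. 18, (cpeps).
* [FordMaynard2024PrimeSieves] K. Ford, J. Maynard, arXiv:2407.14368, Lemma 5.11 (tree:
  `FordMaynardPrimeSumsTuples.lean`).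
-/

noncomputable section

open MeasureTheory Set Filter Finset Asymptotics
open scoped Topology BigOperators

namespace Literature.NumberTheory.Sieve

open Depol RoughTuples
open scoped Classical

namespace RoughMain

/-! ### The test function at level `x` -/

section TestFunction

variable {F : ℝ → ℝ} {D : ℝ}

/-- The rescaling `c = log X₂ / log x`. [folklore] -/
def cScale (x X₂ : ℝ) : ℝ := Real.log X₂ / Real.log x

/-- The convex set `U = {y : ε/c < yᵢ, log X₁/log X₂ < Σ y ≤ 1}`. [cite: Polymath8b2014, §4.5, p. 18] -/
def Uset (ε x X₁ X₂ : ℝ) (r : ℕ) : Set (Fin r → ℝ) :=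
  {y | (∀ i, ε / cScale x X₂ < y i) ∧ Real.log X₁ / Real.log X₂ < ∑ i, y i ∧ ∑ i, y i ≤ 1}

/-- The test function `G(y) = 1_U(y) (∂_{(c y)}F(0))²`. [cite: Polymath8b2014, §4.5, p. 18] -/
def testG (ε x X₁ X₂ : ℝ) (F : ℝ → ℝ) (r : ℕ) (y : Fin r → ℝ) : ℝ :=
  if y ∈ Uset ε x X₁ X₂ r then sqIter F (cScale x X₂ • y) else 0

/-- `U` is convex. [folklore] -/
theorem convex_Uset (ε x X₁ X₂ : ℝ) (r : ℕ) : Convex ℝ (Uset ε x X₁ X₂ r) := by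
  have hlin : IsLinearMap ℝ (fun y : Fin r → ℝ => ∑ i, y i) :=
    ⟨fun y y' => by simp [Finset.sum_add_distrib], fun c y => by simp [Finset.mul_sum]⟩
  have h1 : Convex ℝ {y : Fin r → ℝ | ∀ i, ε / cScale x X₂ < y i} := by
    have : {y : Fin r → ℝ | ∀ i, ε / cScale x X₂ < y i} = ⋂ i, {y | ε / cScale x X₂ < y i} := by ext y; simp
    rw [this]
    exact convex_iInter fun i => convex_halfSpace_gt ⟨fun y y' => rfl, fun c y => rfl⟩ _
  have heq : Uset ε x X₁ X₂ r = {y | ∀ i, ε / cScale x X₂ < y i} ∩ ({y | Real.log X₁ / Real.log X₂ < ∑ i, y i} ∩ {y | ∑ i, y i ≤ 1}) := by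
    ext y; simp only [Uset, Set.mem_setOf_eq, Set.mem_inter_iff]
  rw [heq]
  exact h1.inter ((convex_halfSpace_gt hlin _).inter (convex_halfSpace_le hlin _))

/-- `U` is measurable. [folklore] -/
theorem measurableSet_Uset (ε x X₁ X₂ : ℝ) (r : ℕ) : MeasurableSet (Uset ε x X₁ X₂ r) := by
  have hs : Measurable fun y : Fin r → ℝ => ∑ i, y i := Finset.measurable_sum _ fun i _ => measurable_pi_apply i
  have h1 : MeasurableSet {y : Fin r → ℝ | ∀ i, ε / cScale x X₂ < y i} := by
    have : {y : Fin r → ℝ | ∀ i, ε / cScale x X₂ < y i} = ⋂ i, {y | ε / cScale x X₂ < y i} := by ext y; simp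
    rw [this]
    exact MeasurableSet.iInter fun i => measurableSet_lt measurable_const (measurable_pi_apply i)
  have heq : Uset ε x X₁ X₂ r = {y | ∀ i, ε / cScale x X₂ < y i} ∩ ({y | Real.log X₁ / Real.log X₂ < ∑ i, y i} ∩ {y | ∑ i, y i ≤ 1}) := by
    ext y; simp only [Uset, Set.mem_setOf_eq, Set.mem_inter_iff]
  rw [heq]
  exact h1.inter ((measurableSet_lt measurable_const hs).inter (measurableSet_le hs measurable_const))

/-- `G` is measurable. [folklore] -/
theorem measurable_testG {F : ℝ → ℝ} (hF : Continuous F) (ε x X₁ X₂ : ℝ) (r : ℕ) : Measurable (testG ε x X₁ X₂ F r) := by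
  have h1 : Measurable fun y : Fin r → ℝ => sqIter F (cScale x X₂ • y) := by
    have hc : Continuous fun y : Fin r → ℝ => dIterV r (cScale x X₂ • y) F 0 :=
      (continuous_dIterV hF r).comp ((continuous_const_smul (cScale x X₂)).prodMk continuous_const)
    exact (hc.pow 2).measurable
  have : testG ε x X₁ X₂ F r = (Uset ε x X₁ X₂ r).indicator fun y => sqIter F (cScale x X₂ • y) := by
    funext y; rw [testG, Set.indicator_apply]
  rw [this]; exact h1.indicator (measurableSet_Uset ε x X₁ X₂ r)

/-- `G` vanishes off `U`. [folklore] -/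
theorem testG_eq_zero {ε x X₁ X₂ : ℝ} {F : ℝ → ℝ} {r : ℕ} {y : Fin r → ℝ} (hy : y ∉ Uset ε x X₁ X₂ r) :
    testG ε x X₁ X₂ F r y = 0 := if_neg hy

/-- `altSum` is Lipschitz: `|altSum(u) - altSum(u')| ≤ 2^r r D ‖u - u'‖`. [folklore] -/
theorem abs_altSum_sub_le (hF : NiceFun F D) {r : ℕ} (u u' : Fin r → ℝ) :
    |altSum F r u 0 - altSum F r u' 0| ≤ 2 ^ r * r * D * ‖u - u'‖ := by
  unfold altSum
  rw [← Finset.sum_sub_distrib]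
  calc |∑ S : Finset (Fin r), ((-1 : ℝ) ^ S.card * F (0 + ∑ i ∈ S, u i) - (-1 : ℝ) ^ S.card * F (0 + ∑ i ∈ S, u' i))|
      ≤ ∑ S : Finset (Fin r), |(-1 : ℝ) ^ S.card * F (0 + ∑ i ∈ S, u i) - (-1 : ℝ) ^ S.card * F (0 + ∑ i ∈ S, u' i)| :=
        Finset.abs_sum_le_sum_abs _ _
    _ ≤ ∑ _S : Finset (Fin r), r * D * ‖u - u'‖ := by
        refine Finset.sum_le_sum fun S _ => ?_
        rw [← mul_sub, abs_mul, abs_pow, abs_neg, abs_one, one_pow, one_mul]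
        refine (hF.abs_sub_le _ _).trans ?_
        rw [zero_add, zero_add, ← Finset.sum_sub_distrib, mul_comm (r : ℝ) D, mul_assoc]
        refine mul_le_mul_of_nonneg_left ?_ hF.nonneg
        calc |∑ i ∈ S, (u i - u' i)| ≤ ∑ i ∈ S, |u i - u' i| := Finset.abs_sum_le_sum_abs _ _
          _ ≤ ∑ _i ∈ S, ‖u - u'‖ := Finset.sum_le_sum fun i _ => by
              rw [← Real.norm_eq_abs]; exact norm_le_pi_norm (u - u') i
          _ = S.card * ‖u - u'‖ := by rw [Finset.sum_const, nsmul_eq_mul]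
          _ ≤ r * ‖u - u'‖ := by
              refine mul_le_mul_of_nonneg_right ?_ (norm_nonneg _)
              exact_mod_cast (Finset.card_le_univ S).trans_eq (Fintype.card_fin r)
    _ = 2 ^ r * r * D * ‖u - u'‖ := by
        rw [Finset.sum_const, Finset.card_univ, Fintype.card_finset, Fintype.card_fin, nsmul_eq_mul]; push_cast; ring

/-- `|altSum F (n+1) u 0| ≤ 2^n D |u 0|`. [folklore] -/
theorem abs_altSum_le (hF : NiceFun F D) {n : ℕ} (u : Fin (n + 1) → ℝ) : |altSum F (n + 1) u 0| ≤ 2 ^ n * D * |u 0| := by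
  have h := abs_dIterV_zero_le hF u
  rwa [dIterV_eq_altSum, abs_mul, abs_pow, abs_neg, abs_one, one_pow, one_mul] at h

/-- **Lipschitz and size bounds for the test function** on `U` (when `0 < c ≤ 2`, `ε ≥ 0`):
`|G y - G y'| ≤ 4^{n+2} (n+1) D² ‖y - y'‖` and `|G y| ≤ 4^n D² · 4`… precisely `≤ (2^n D · 2)²`. [folklore] -/
theorem testG_lipschitz_bound (hF : NiceFun F D) {ε x X₁ X₂ : ℝ} (hε : 0 ≤ ε) (hc0 : 0 < cScale x X₂) (hc2 : cScale x X₂ ≤ 2)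
    (n : ℕ) :
    (∀ y ∈ Uset ε x X₁ X₂ (n + 1), ∀ y' ∈ Uset ε x X₁ X₂ (n + 1),
        |testG ε x X₁ X₂ F (n + 1) y - testG ε x X₁ X₂ F (n + 1) y'| ≤
          (2 * (2 ^ n * D * 2) * (2 ^ (n + 1) * (n + 1) * D) * 2) * ‖y - y'‖) ∧
      ∀ y, |testG ε x X₁ X₂ F (n + 1) y| ≤ (2 ^ n * D * 2) ^ 2 := by
  set c := cScale x X₂ with hc
  have hD := hF.nonneg
  -- on `U`, `|altSum (c y)| ≤ 2^n D · 2`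
  have hsize : ∀ y ∈ Uset ε x X₁ X₂ (n + 1), |altSum F (n + 1) (c • y) 0| ≤ 2 ^ n * D * 2 := by
    intro y hy
    obtain ⟨h1, -, h3⟩ := hy
    refine (abs_altSum_le hF _).trans (mul_le_mul_of_nonneg_left ?_ (by positivity))
    have hy0 : 0 ≤ y 0 := le_trans (div_nonneg hε hc0.le) (h1 0).le
    have hyle : y 0 ≤ 1 := by
      have : y 0 ≤ ∑ i, y i := Finset.single_le_sum (f := y) (fun i _ => le_trans (div_nonneg hε hc0.le) (h1 i).le) (Finset.mem_univ 0)
      linarith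
    rw [Pi.smul_apply, smul_eq_mul, abs_of_nonneg (mul_nonneg hc0.le hy0)]
    nlinarith
  constructor
  · intro y hy y' hy'
    rw [testG, testG, if_pos hy, if_pos hy', sqIter_eq_altSum_sq, sqIter_eq_altSum_sq, sq_sub_sq, abs_mul]
    have hsum : |altSum F (n + 1) (c • y) 0 + altSum F (n + 1) (c • y') 0| ≤ 2 * (2 ^ n * D * 2) :=
      (abs_add_le _ _).trans (by linarith [hsize y hy, hsize y' hy'])
    have hdiff : |altSum F (n + 1) (c • y) 0 - altSum F (n + 1) (c • y') 0| ≤ (2 ^ (n + 1) * (n + 1) * D) * 2 * ‖y - y'‖ := by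
      refine (abs_altSum_sub_le hF _ _).trans ?_
      rw [← smul_sub, norm_smul, Real.norm_eq_abs, abs_of_pos hc0]
      have : c * ‖y - y'‖ ≤ 2 * ‖y - y'‖ := mul_le_mul_of_nonneg_right hc2 (norm_nonneg _)
      calc (2 : ℝ) ^ (n + 1) * ((n + 1 : ℕ) : ℝ) * D * (c * ‖y - y'‖) ≤ 2 ^ (n + 1) * ((n + 1 : ℕ) : ℝ) * D * (2 * ‖y - y'‖) :=
            mul_le_mul_of_nonneg_left this (by positivity)
        _ = _ := by push_cast; ring
    calc |altSum F (n + 1) (c • y) 0 + altSum F (n + 1) (c • y') 0| * |altSum F (n + 1) (c • y) 0 - altSum F (n + 1) (c • y') 0|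
        ≤ (2 * (2 ^ n * D * 2)) * ((2 ^ (n + 1) * (n + 1) * D) * 2 * ‖y - y'‖) :=
          mul_le_mul hsum hdiff (abs_nonneg _) (by positivity)
      _ = _ := by ring
  · intro y
    by_cases hy : y ∈ Uset ε x X₁ X₂ (n + 1)
    · rw [testG, if_pos hy, sqIter_eq_altSum_sq, abs_of_nonneg (sq_nonneg _), ← sq_abs]
      exact pow_le_pow_left₀ (abs_nonneg _) (hsize y hy) 2
    · rw [testG_eq_zero hy, abs_zero]; positivity

end TestFunction

/-! ### The prime-tuple sum and the comparison integral at level `x` -/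

section Identities

variable {F : ℝ → ℝ} {D : ℝ} {ε x : ℝ} {X₁ X₂ : ℕ}

/-- `c • (log qᵢ / log X₂) = (log qᵢ / log x)`. [folklore] -/
theorem cScale_smul_logVec (hX₂ : 2 ≤ X₂) {r : ℕ} (q : Fin r → ℕ) :
    cScale x X₂ • FordMaynard.logVec (X₂ : ℝ) q = logVecX x q := by
  have hlog : Real.log (X₂ : ℝ) ≠ 0 := (Real.log_pos (by exact_mod_cast hX₂)).ne'
  funext i
  simp only [Pi.smul_apply, smul_eq_mul, FordMaynard.logVec, logVecX, cScale]
  field_simp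

/-- Membership of `log q / log X₂` in `U` is the arithmetic condition on the tuple. [folklore] -/
theorem logVec_mem_Uset_iff (hx : 1 < x) (hX₁ : 1 ≤ X₁) (hX₂ : 2 ≤ X₂) {r : ℕ}
    {q : Fin r → ℕ} (hq : ∀ i, (q i).Prime) :
    FordMaynard.logVec (X₂ : ℝ) q ∈ Uset ε x X₁ X₂ r ↔
      (∀ i, x ^ ε < (q i : ℝ)) ∧ X₁ < ∏ i, q i ∧ ∏ i, q i ≤ X₂ := by
  have hx0 : 0 < x := by linarith
  have hlogx : 0 < Real.log x := Real.log_pos hx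
  have hX₂pos : (0 : ℝ) < X₂ := by exact_mod_cast (show 0 < X₂ by omega)
  have hlog2 : 0 < Real.log (X₂ : ℝ) := Real.log_pos (by exact_mod_cast hX₂)
  have hc : cScale x X₂ = Real.log X₂ / Real.log x := rfl
  have hcpos : 0 < cScale x X₂ := div_pos hlog2 hlogx
  have hq0 : ∀ i, (0 : ℝ) < q i := fun i => by exact_mod_cast (hq i).pos
  have hprod0 : (0 : ℝ) < ∏ i, (q i : ℝ) := Finset.prod_pos fun i _ => hq0 i
  have hsumlog : ∑ i, FordMaynard.logVec (X₂ : ℝ) q i = Real.log (∏ i, (q i : ℝ)) / Real.log X₂ := by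
    rw [Real.log_prod (s := Finset.univ) (fun i _ => (hq0 i).ne'), Finset.sum_div]; rfl
  simp only [Uset, Set.mem_setOf_eq]
  rw [hsumlog]
  refine and_congr (forall_congr' fun i => ?_) (and_congr ?_ ?_)
  · -- `ε/c < log q / log X₂ ↔ x^ε < q`
    rw [FordMaynard.logVec, hc, div_div_eq_mul_div, div_lt_div_iff_of_pos_right hlog2, ← Real.log_rpow hx0,
      Real.log_lt_log_iff (Real.rpow_pos_of_pos hx0 ε) (hq0 i)]
  · rw [div_lt_div_iff_of_pos_right hlog2, Real.log_lt_log_iff (by exact_mod_cast (show 0 < X₁ by omega)) hprod0]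
    norm_cast
  · rw [div_le_one hlog2, Real.log_le_log_iff hprod0 hX₂pos]
    norm_cast

/-- **The prime-tuple sum of the test function is the truncated tuple sum**. [cite: Polymath8b2014, §4.5, p. 18] -/
theorem primeTupleSum_testG_eq (hx : 1 < x) (hX₁ : 1 ≤ X₁) (hX₂ : 2 ≤ X₂) (r : ℕ) :
    FordMaynard.primeTupleSum r (X₂ : ℝ) (testG ε x X₁ X₂ F r) = ∑ q ∈ allTuples X₁ X₂ (x ^ ε) r, sqIter F (logVecX x q) := by
  rw [FordMaynard.primeTupleSum, Nat.floor_natCast, allTuples, Finset.sum_filter]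
  refine Finset.sum_congr rfl fun q hq => ?_
  have hpr : ∀ i, (q i).Prime := fun i => (Nat.mem_primesLE.1 (Fintype.mem_piFinset.1 hq i)).2
  rw [testG]
  simp only [logVec_mem_Uset_iff hx hX₁ hX₂ hpr, cScale_smul_logVec hX₂]

/-- The comparison integral as the main-term integral: the a.e. identity of the integrands after
rescaling `u = c y`. [folklore] -/
theorem testG_mul_tupleWeight_eq (hx : 1 < x) (hX₂ : 2 ≤ X₂) (F : ℝ → ℝ)
    {r : ℕ} (u : Fin r → ℝ) (hu : ∀ i, u i ≠ ε) :
    (cScale x X₂ ^ r)⁻¹ * (testG ε x X₁ X₂ F r ((cScale x X₂)⁻¹ • u) * FordMaynard.tupleWeight (X₂ : ℝ) ((cScale x X₂)⁻¹ • u)) =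
      mainTermIntegrand ε x F (Real.log X₁ / Real.log x) (Real.log X₂ / Real.log x) u := by
  have hx0 : 0 < x := by linarith
  have hlogx : 0 < Real.log x := Real.log_pos hx
  have hX₂pos : (0 : ℝ) < X₂ := by exact_mod_cast (show 0 < X₂ by omega)
  have hlog2 : 0 < Real.log (X₂ : ℝ) := Real.log_pos (by exact_mod_cast hX₂)
  have hcpos : 0 < cScale x X₂ := div_pos hlog2 hlogx
  have hcne : cScale x X₂ ≠ 0 := hcpos.ne'
  -- the membership condition
  have hmem : (((cScale x X₂)⁻¹ • u) ∈ Uset ε x X₁ X₂ r) ↔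
      (∀ i, ε < u i) ∧ Real.log X₁ / Real.log x < ∑ i, u i ∧ ∑ i, u i ≤ Real.log X₂ / Real.log x := by
    simp only [Uset, Set.mem_setOf_eq, Pi.smul_apply, smul_eq_mul, ← Finset.mul_sum]
    have e1 : ∀ i, (ε / cScale x X₂ < (cScale x X₂)⁻¹ * u i) ↔ ε < u i := fun i => by
      rw [div_lt_iff₀ hcpos, inv_mul_eq_div, div_mul_cancel₀ _ hcne]
    have e2 : (Real.log X₁ / Real.log X₂ < (cScale x X₂)⁻¹ * ∑ i, u i) ↔ Real.log X₁ / Real.log x < ∑ i, u i := by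
      rw [inv_mul_eq_div, lt_div_iff₀ hcpos, cScale, div_mul_div_comm, mul_comm (Real.log (X₁ : ℝ)),
        mul_div_mul_left _ _ hlog2.ne']
    have e3 : ((cScale x X₂)⁻¹ * ∑ i, u i ≤ 1) ↔ ∑ i, u i ≤ Real.log X₂ / Real.log x := by
      rw [inv_mul_eq_div, div_le_one hcpos]; rfl
    simp only [e1, e2, e3]
  -- the weight
  have hweight : FordMaynard.tupleWeight (X₂ : ℝ) ((cScale x X₂)⁻¹ • u) = cScale x X₂ ^ r * (x ^ (∑ i, u i) * (∏ i, u i)⁻¹) := by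
    rw [FordMaynard.tupleWeight]
    have hterm : ∀ i, (X₂ : ℝ) ^ (((cScale x X₂)⁻¹ • u) i) / ((cScale x X₂)⁻¹ • u) i = cScale x X₂ * (x ^ (u i) * (u i)⁻¹) := by
      intro i
      simp only [Pi.smul_apply, smul_eq_mul]
      have hpow : (X₂ : ℝ) ^ ((cScale x X₂)⁻¹ * u i) = x ^ (u i) := by
        rw [Real.rpow_def_of_pos hX₂pos, Real.rpow_def_of_pos hx0]
        congr 1
        rw [cScale]; field_simp
      rw [hpow, div_eq_mul_inv, mul_inv, inv_inv]; ring
    simp_rw [hterm]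
    rw [Finset.prod_mul_distrib, Finset.prod_const, Finset.card_univ, Fintype.card_fin, Finset.prod_mul_distrib,
      ← Real.rpow_sum_of_pos hx0, Finset.prod_inv_distrib]
  rw [hweight, testG, smul_inv_smul₀ hcne, mainTermIntegrand]
  -- compare the two conditions: strict vs. non-strict lower bounds
  have hcond : ((∀ i, ε < u i) ∧ Real.log ↑X₁ / Real.log x < ∑ i, u i ∧ ∑ i, u i ≤ Real.log ↑X₂ / Real.log x) ↔
      ((∀ i, ε ≤ u i) ∧ Real.log ↑X₁ / Real.log x < ∑ i, u i ∧ ∑ i, u i ≤ Real.log ↑X₂ / Real.log x) :=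
    and_congr (forall_congr' fun i => ⟨le_of_lt, fun h => lt_of_le_of_ne h (hu i).symm⟩) Iff.rfl
  simp only [hmem, hcond]
  split_ifs
  · field_simp
  · simp

/-- **The comparison integral is the main-term integral in peeling form**:
`∫ G · tupleWeight = (n+1)! ∫_{ℓ₁}^{ℓ₂} x^t Mfun ε n t F dt`, `ℓⱼ = log Xⱼ / log x`. [cite: Polymath8b2014, §4.5, p. 18] -/
theorem primeTupleIntegral_testG_eq (hε : 0 < ε) (hx : 1 < x) (hX₁ : 1 ≤ X₁) (hX₂ : 2 ≤ X₂) (hX₁₂ : X₁ ≤ X₂)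
    (hF : NiceFun F D) (n : ℕ) :
    FordMaynard.primeTupleIntegral (n + 1) (X₂ : ℝ) (testG ε x X₁ X₂ F (n + 1)) =
      (Nat.factorial (n + 1) : ℝ) * ∫ t in (Real.log X₁ / Real.log x)..(Real.log X₂ / Real.log x), x ^ t * Mfun ε n t F := by
  have hx0 : 0 < x := by linarith
  have hlogx : 0 < Real.log x := Real.log_pos hx
  have hlog2 : 0 < Real.log (X₂ : ℝ) := Real.log_pos (by exact_mod_cast hX₂)
  set c := cScale x X₂ with hc
  have hcpos : 0 < c := div_pos hlog2 hlogx
  have hcne : c ≠ 0 := hcpos.ne'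
  have hℓ : Real.log X₁ / Real.log x ≤ Real.log X₂ / Real.log x :=
    div_le_div_of_nonneg_right (Real.log_le_log (by exact_mod_cast (show 0 < X₁ by omega)) (by exact_mod_cast hX₁₂)) hlogx.le
  rw [← integral_mainTermIntegrand_eq hε hx.le hF hℓ n, FordMaynard.primeTupleIntegral]
  -- rescale `y = c⁻¹ u`
  set f : (Fin (n + 1) → ℝ) → ℝ := fun u =>
    testG ε x X₁ X₂ F (n + 1) (c⁻¹ • u) * FordMaynard.tupleWeight (X₂ : ℝ) (c⁻¹ • u) with hf
  have hcomp : (fun y : Fin (n + 1) → ℝ => testG ε x X₁ X₂ F (n + 1) y * FordMaynard.tupleWeight (X₂ : ℝ) y) =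
      fun y => f (c • y) := by
    funext y; simp only [hf, inv_smul_smul₀ hcne]
  rw [hcomp, Measure.integral_comp_smul volume f c, Module.finrank_fin_fun, smul_eq_mul,
    abs_of_nonneg (inv_nonneg.2 (pow_nonneg hcpos.le _)), ← MeasureTheory.integral_const_mul]
  refine integral_congr_ae ?_
  have hae : ∀ᵐ u : Fin (n + 1) → ℝ, ∀ i, u i ≠ ε := by
    rw [MeasureTheory.volume_pi]
    exact ae_all_iff.2 fun i => Measure.ae_eval_ne (μ := fun _ : Fin (n + 1) => (volume : Measure ℝ)) i ε
  filter_upwards [hae] with u hu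
  exact testG_mul_tupleWeight_eq hx hX₂ F u hu

end Identities


/-! ### The window `(X₁, X₂]` as `x → ∞` -/

section Window

/-- Eventual facts about the window: `1 ≤ X₁ ≤ X₂`, `2 ≤ X₂`, `x ≤ X₂ ≤ 3x`, `x/2 ≤ X₁ ≤ 2x`,
`|X₂ - X₁ - x| ≤ 2`, `4 ≤ x`, `3 ≤ x^ε`. [folklore] -/
theorem eventually_window (h₀ : ℤ) {ε : ℝ} (hε : 0 < ε) :
    ∀ᶠ x : ℝ in atTop, 1 ≤ thetaX1 h₀ x ∧ thetaX1 h₀ x ≤ thetaX2 h₀ x ∧ 2 ≤ thetaX2 h₀ x ∧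
      x ≤ (thetaX2 h₀ x : ℝ) ∧ (thetaX2 h₀ x : ℝ) ≤ 3 * x ∧ x / 2 ≤ (thetaX1 h₀ x : ℝ) ∧ (thetaX1 h₀ x : ℝ) ≤ 2 * x ∧
      |(thetaX2 h₀ x : ℝ) - thetaX1 h₀ x - x| ≤ 2 ∧ 4 ≤ x ∧ 3 ≤ x ^ ε := by
  have t1 : Tendsto (fun x : ℝ => x ^ ε) atTop atTop := tendsto_rpow_atTop hε
  filter_upwards [eventually_ge_atTop (2 * ((h₀.natAbs : ℝ) + 2)), t1.eventually_ge_atTop 3] with x hx hxε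
  have habs : ((h₀.natAbs : ℕ) : ℝ) = |(h₀ : ℝ)| := by rw [Nat.cast_natAbs, Int.cast_abs]
  have hh1 : -(h₀ : ℝ) ≤ h₀.natAbs := by rw [habs]; exact neg_le_abs _
  have hh2 : (h₀ : ℝ) ≤ h₀.natAbs := by rw [habs]; exact le_abs_self _
  have h0 : (0 : ℝ) ≤ h₀.natAbs := Nat.cast_nonneg _
  have hx' : (h₀.natAbs : ℝ) + 2 ≤ x := by linarith
  obtain ⟨a1, a2, a3, a4, a5, a6, -, -⟩ := thetaX_bounds h₀ hx'
  have hX₂2 : 2 ≤ thetaX2 h₀ x := by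
    have : (2 : ℝ) ≤ thetaX2 h₀ x := by linarith
    exact_mod_cast this
  refine ⟨a1, a2, hX₂2, by linarith, by linarith, by linarith, by linarith, ?_, by linarith, hxε⟩
  rw [abs_le]; constructor <;> linarith

/-- `log X / log x → 1` when `x/2 ≤ X ≤ 3x`: quantitative form `|log X/log x - 1| ≤ log 3 / log x`. [folklore] -/
theorem abs_log_div_log_sub_one_le {x X : ℝ} (hx : 4 ≤ x) (h1 : x / 2 ≤ X) (h2 : X ≤ 3 * x) :
    |Real.log X / Real.log x - 1| ≤ Real.log 3 / Real.log x := by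
  have hx0 : 0 < x := by linarith
  have hX0 : 0 < X := by linarith
  have hlog : 0 < Real.log x := Real.log_pos (by linarith)
  rw [div_sub_one hlog.ne', abs_div, abs_of_pos hlog, div_le_div_iff_of_pos_right hlog, abs_le]
  constructor
  · have : Real.log (x / 2) ≤ Real.log X := Real.log_le_log (by positivity) h1
    rw [Real.log_div hx0.ne' (by norm_num)] at this
    have h23 : Real.log 2 ≤ Real.log 3 := Real.log_le_log (by norm_num) (by norm_num)
    linarith
  · have : Real.log X ≤ Real.log (3 * x) := Real.log_le_log hX0 h2
    rw [Real.log_mul (by norm_num) hx0.ne'] at this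
    linarith

/-- The scale `c = log X₂/log x` is in `(0, 2]` when `2 ≤ x ≤ X₂ ≤ 3x`, `x ≥ 4`. [folklore] -/
theorem cScale_pos_le_two {x : ℝ} {X₂ : ℕ} (hx : 4 ≤ x) (h1 : x ≤ X₂) (h2 : (X₂ : ℝ) ≤ 3 * x) :
    0 < cScale x X₂ ∧ cScale x X₂ ≤ 2 := by
  have hlog : 0 < Real.log x := Real.log_pos (by linarith)
  have hlog2 : 0 < Real.log (X₂ : ℝ) := Real.log_pos (by linarith)
  refine ⟨div_pos hlog2 hlog, ?_⟩
  rw [cScale, div_le_iff₀ hlog]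
  calc Real.log (X₂ : ℝ) ≤ Real.log (3 * x) := Real.log_le_log (by linarith) h2
    _ = Real.log 3 + Real.log x := Real.log_mul (by norm_num) (by linarith)
    _ ≤ Real.log x + Real.log x := by
        have : Real.log 3 ≤ Real.log x := Real.log_le_log (by norm_num) (by linarith)
        linarith
    _ = 2 * Real.log x := by ring

end Window

/-! ### Continuity of the truncated constants in `a` -/

section Continuity

variable {F : ℝ → ℝ} {D : ℝ}

/-- `t ↦ Mfun ε n t F` is continuous on `(ε, ∞)`. [folklore] -/
theorem continuousOn_Mfun_Ioi {ε : ℝ} (hε : 0 < ε) (hF : NiceFun F D) :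
    ∀ n : ℕ, ContinuousOn (fun t => Mfun ε n t F) (Set.Ioi ε)
  | 0 => by
    refine ((famCont_Kfun 0).continuous_in_a hF).continuousOn.congr fun t ht => ?_
    rw [Mfun_zero]; simp only; rw [if_pos (le_of_lt ht)]; rfl
  | n + 1 => ((famCont_Mfun_succ hε n).continuous_in_a hF).continuousOn

end Continuity

/-! ### The truncated sum of order `r` -/

section PerOrder

variable {F : ℝ → ℝ} {D : ℝ}

/-- **`Σ_{m ∈ roughSqfree r} λ_F(m)² = (Mfun ε (r-1) 1 F + o(1)) x / log x`** (`r = n + 1`, `F` nice,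
`0 < ε ≤ 1/2`). [cite: Polymath8b2014, §4.5, p. 18, (cpeps)] -/
theorem sum_roughSqfree_isLittleO (hF : NiceFun F D) {ε : ℝ} (hε : 0 < ε) (hε1 : ε ≤ 1 / 2) (h₀ : ℤ) (n : ℕ) :
    (fun x : ℝ => ∑ m ∈ roughSqfree (thetaX1 h₀ x) (thetaX2 h₀ x) (x ^ ε) (n + 1), divisorSumWeight F x m ^ 2 -
        Mfun ε n 1 F * (x / Real.log x)) =o[atTop] fun x : ℝ => x / Real.log x := by
  have hD := hF.nonneg
  -- the Ford–Maynard comparison, with `η' = ε/2`, `A = 2`, `s = n + 1`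
  obtain ⟨C, hC0, X₀, hX₀2, htool⟩ := FordMaynard.exists_primeTupleSum_approx (ε / 2) (by positivity) (by linarith) 2 (n + 1)
  set K : ℝ := 2 * (2 ^ n * D * 2) * (2 ^ (n + 1) * (n + 1) * D) * 2 with hK
  set MG : ℝ := (2 ^ n * D * 2) ^ 2 with hMG
  have hK0 : 0 ≤ K := by positivity
  have hMG0 : 0 ≤ MG := by positivity
  set M₁ : ℝ := Mfun ε n 1 F with hM₁
  -- continuity of `M` at `1`
  have hMcont : ContinuousOn (fun t => Mfun ε n t F) (Set.Ioi ε) := continuousOn_Mfun_Ioi hε hF n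
  have hMat : ContinuousAt (fun t => Mfun ε n t F) 1 :=
    hMcont.continuousAt (Ioi_mem_nhds (by linarith))
  rw [Asymptotics.isLittleO_iff]
  intro δ hδ
  -- `|M t - M 1| < δ/16` near `1`
  obtain ⟨ρ, hρ, hρM⟩ : ∃ ρ > 0, ∀ t, |t - 1| < ρ → |Mfun ε n t F - M₁| < δ / 16 := by
    have h := Metric.continuousAt_iff.1 hMat (δ / 16) (by positivity)
    obtain ⟨ρ, hρ, h⟩ := h
    exact ⟨ρ, hρ, fun t ht => by have := h (by rwa [Real.dist_eq]); rwa [Real.dist_eq] at this⟩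
  -- eventual facts
  have e_log : Tendsto (fun x : ℝ => Real.log x) atTop atTop := Real.tendsto_log_atTop
  have hX₂inf : Tendsto (fun x : ℝ => (thetaX2 h₀ x : ℝ)) atTop atTop := tendsto_thetaX2 h₀
  have e_pow : ∀ᶠ x : ℝ in atTop, Real.log x ≤ δ / (24 * (MG * (n + 1) ^ (n + 1)) + 1) * x ^ ε := by
    have h := (isLittleO_log_rpow_atTop hε).def (show 0 < δ / (24 * (MG * (n + 1) ^ (n + 1)) + 1) by positivity)
    filter_upwards [h, eventually_ge_atTop (1 : ℝ)] with x hx hx1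
    rwa [Real.norm_of_nonneg (Real.log_nonneg hx1), Real.norm_of_nonneg (Real.rpow_nonneg (by linarith) _)] at hx
  filter_upwards [eventually_window h₀ hε, hX₂inf.eventually_ge_atTop X₀,
    e_log.eventually_ge_atTop (Real.log 3 / ρ + 1), e_log.eventually_ge_atTop 3,
    eventually_ge_atTop (16 * (|M₁| + 1) / δ),
    e_log.eventually_ge_atTop (16 * (C * (K + MG) * 3 + 1) / δ), e_pow]
    with x hwin hX₀ hlogρ hL3 hxM hlog2 hpowε
  obtain ⟨hX₁1, hX₁₂, hX₂2, hxX₂, hX₂3, hX₁lo, hX₁hi, hdiff, hx4, hxε3⟩ := hwin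
  set X₁ := thetaX1 h₀ x with hX₁def
  set X₂ := thetaX2 h₀ x with hX₂def
  have hx1 : 1 < x := by linarith only [hx4]
  have hx0 : 0 < x := by linarith only [hx4]
  have hlog : 0 < Real.log x := Real.log_pos hx1
  have hlog1' : 1 ≤ Real.log x := by linarith only [hL3]
  have hlog3 : Real.log 3 < 3 / 2 := by
    rw [Real.log_lt_iff_lt_exp (by norm_num)]
    have := Real.quadratic_le_exp_of_nonneg (show (0:ℝ) ≤ 3 / 2 by norm_num)
    nlinarith only [this]
  have hlog3pos : 0 < Real.log 3 := Real.log_pos (by norm_num)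
  set L := Real.log x with hL
  set ℓ₁ := Real.log X₁ / L with hℓ₁
  set ℓ₂ := Real.log X₂ / L with hℓ₂
  have hxL : 0 < x / L := div_pos hx0 hlog
  obtain ⟨hc0, hc2⟩ := cScale_pos_le_two hx4 hxX₂ hX₂3
  -- Step 1: the sum as a tuple sum
  have hfact : (Nat.factorial (n + 1) : ℝ) ≠ 0 := by exact_mod_cast Nat.factorial_ne_zero _
  have hS : ∑ m ∈ roughSqfree X₁ X₂ (x ^ ε) (n + 1), divisorSumWeight F x m ^ 2 =
      (Nat.factorial (n + 1) : ℝ)⁻¹ * (∑ q ∈ allTuples X₁ X₂ (x ^ ε) (n + 1), sqIter F (logVecX x q) -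
        ∑ q ∈ (allTuples X₁ X₂ (x ^ ε) (n + 1)).filter (fun q => ¬ Function.Injective q), sqIter F (logVecX x q)) := by
    rw [eq_inv_mul_iff_mul_eq₀ hfact, factorial_mul_sum_lambda_sq, goodTuples_eq_filter,
      ← Finset.sum_filter_add_sum_filter_not (allTuples X₁ X₂ (x ^ ε) (n + 1)) (fun q => Function.Injective q)]
    ring
  -- Step 2: the tool
  have hlip := testG_lipschitz_bound hF (ε := ε) (x := x) (X₁ := X₁) (X₂ := X₂) hε.le hc0 hc2 n
  have htool_x := htool X₂ hX₀ (Uset ε x X₁ X₂ (n + 1)) (testG ε x X₁ X₂ F (n + 1)) K MG 1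
    (convex_Uset _ _ _ _ _) (measurableSet_Uset _ _ _ _ _)
    (fun y hy i => by
      have h1 := hy.1 i
      have : ε / 2 ≤ ε / cScale x X₂ := div_le_div_of_nonneg_left hε.le hc0 hc2
      linarith)
    (fun y hy => hy.2.2) le_rfl hK0 hMG0 (measurable_testG hF.continuous _ _ _ _ _) hlip.1 hlip.2
    (fun y hy => testG_eq_zero hy)
  rw [primeTupleSum_testG_eq hx1 hX₁1 hX₂2, primeTupleIntegral_testG_eq hε hx1 hX₁1 hX₂2 hX₁₂ hF n,
    Real.rpow_one] at htool_x
  clear htool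
  -- Step 3: the non-injective tuples
  have hnon : |∑ q ∈ (allTuples X₁ X₂ (x ^ ε) (n + 1)).filter (fun q => ¬ Function.Injective q), sqIter F (logVecX x q)| ≤
      MG * ((n + 1 : ℝ) ^ (n + 1) * ((X₂ : ℝ) / ⌊x ^ ε⌋₊)) := by
    have hterm : ∀ q ∈ (allTuples X₁ X₂ (x ^ ε) (n + 1)).filter (fun q => ¬ Function.Injective q), |sqIter F (logVecX x q)| ≤ MG := by
      intro q hq
      obtain ⟨hq1, -⟩ := Finset.mem_filter.1 hq
      have hpr : ∀ i, (q i).Prime := fun i =>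
        (Nat.mem_primesLE.1 (Fintype.mem_piFinset.1 (Finset.mem_filter.1 hq1).1 i)).2
      have hmem : FordMaynard.logVec (X₂ : ℝ) q ∈ Uset ε x X₁ X₂ (n + 1) :=
        (logVec_mem_Uset_iff hx1 hX₁1 hX₂2 hpr).2 (Finset.mem_filter.1 hq1).2
      have := hlip.2 (FordMaynard.logVec (X₂ : ℝ) q)
      rwa [testG, if_pos hmem, cScale_smul_logVec hX₂2] at this
    calc |∑ q ∈ (allTuples X₁ X₂ (x ^ ε) (n + 1)).filter (fun q => ¬ Function.Injective q), sqIter F (logVecX x q)|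
        ≤ ∑ q ∈ (allTuples X₁ X₂ (x ^ ε) (n + 1)).filter (fun q => ¬ Function.Injective q), |sqIter F (logVecX x q)| :=
          Finset.abs_sum_le_sum_abs _ _
      _ ≤ ∑ _q ∈ (allTuples X₁ X₂ (x ^ ε) (n + 1)).filter (fun q => ¬ Function.Injective q), MG := Finset.sum_le_sum hterm
      _ = ((allTuples X₁ X₂ (x ^ ε) (n + 1)).filter (fun q => ¬ Function.Injective q)).card * MG := by
          rw [Finset.sum_const, nsmul_eq_mul]
      _ ≤ ((n + 1 : ℝ) ^ (n + 1) * (sqMultiples X₂ (x ^ ε)).card) * MG := by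
          refine mul_le_mul_of_nonneg_right ?_ hMG0
          have := card_nonInjective_le X₁ X₂ (x ^ ε) (n + 1)
          push_cast at this
          exact this
      _ ≤ ((n + 1 : ℝ) ^ (n + 1) * ((X₂ : ℝ) / ⌊x ^ ε⌋₊)) * MG := by
          refine mul_le_mul_of_nonneg_right (mul_le_mul_of_nonneg_left (card_sqMultiples_le (by linarith)) (by positivity)) hMG0
      _ = _ := by ring
  -- Step 4: the integral against `M(1)`
  have hℓ₁₂ : ℓ₁ ≤ ℓ₂ := div_le_div_of_nonneg_right
    (Real.log_le_log (by exact_mod_cast (show 0 < X₁ by omega)) (by exact_mod_cast hX₁₂)) hlog.le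
  have hℓ₁bd := abs_log_div_log_sub_one_le hx4 hX₁lo (by linarith only [hX₁hi, hx4])
  have hℓ₂bd := abs_log_div_log_sub_one_le hx4 (by linarith only [hxX₂, hx4]) hX₂3
  rw [abs_le] at hℓ₁bd hℓ₂bd
  have h3L : Real.log 3 / L < 1 / 2 := by
    rw [div_lt_iff₀ hlog]; nlinarith only [hlog3, hL3]
  have hℓ₁ε : ε < ℓ₁ := by
    have : -(Real.log 3 / L) ≤ ℓ₁ - 1 := hℓ₁bd.1
    linarith only [this, h3L, hε1]
  have h3ρ : Real.log 3 / L < ρ := by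
    rw [div_lt_iff₀ hlog]
    have h1 : Real.log 3 / ρ < L := by linarith only [hlogρ]
    rw [div_lt_iff₀ hρ] at h1
    linarith only [h1]
  have hρℓ : ∀ t ∈ Set.Icc ℓ₁ ℓ₂, |t - 1| < ρ := by
    intro t ht
    rw [abs_lt]
    constructor <;> linarith only [ht.1, ht.2, hℓ₁bd.1, hℓ₂bd.2, h3ρ]
  have hMon : ContinuousOn (fun t => Mfun ε n t F) (Set.Icc ℓ₁ ℓ₂) :=
    hMcont.mono fun t ht => lt_of_lt_of_le hℓ₁ε ht.1
  have hint := abs_integral_rpow_mul_sub_le hx1 hℓ₁₂ hMon (η := δ / 16) fun t ht => (hρM t (hρℓ t ht)).le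
  have hxpow : ∀ {X : ℝ}, 0 < X → x ^ (Real.log X / L) = X := fun {X} hX => by
    rw [Real.rpow_def_of_pos hx0, mul_div_cancel₀ _ hlog.ne', Real.exp_log hX]
  have hxℓ₂ : x ^ ℓ₂ = X₂ := hxpow (by exact_mod_cast (show 0 < X₂ by omega))
  have hxℓ₁ : x ^ ℓ₁ = X₁ := hxpow (by exact_mod_cast (show 0 < X₁ by omega))
  rw [hxℓ₂, hxℓ₁] at hint
  -- Step 5: assemble.  Notation: `I = ∫_{ℓ₁}^{ℓ₂} x^t M`, `Sall`, `Snon`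
  set I := ∫ t in ℓ₁..ℓ₂, x ^ t * Mfun ε n t F with hI
  set Sall := ∑ q ∈ allTuples X₁ X₂ (x ^ ε) (n + 1), sqIter F (logVecX x q) with hSall
  set Snon := ∑ q ∈ (allTuples X₁ X₂ (x ^ ε) (n + 1)).filter (fun q => ¬ Function.Injective q), sqIter F (logVecX x q) with hSnon
  have hdecomp : (Nat.factorial (n + 1) : ℝ)⁻¹ * (Sall - Snon) - M₁ * (x / L) =
      (I - M₁ * (((X₂ : ℝ) - X₁) / L)) + M₁ * (((X₂ : ℝ) - X₁) / L - x / L) +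
        (Nat.factorial (n + 1) : ℝ)⁻¹ * (Sall - (Nat.factorial (n + 1) : ℝ) * I) - (Nat.factorial (n + 1) : ℝ)⁻¹ * Snon := by
    field_simp; ring
  rw [hS, Real.norm_eq_abs, Real.norm_eq_abs, abs_of_pos hxL, hdecomp]
  -- the four error terms
  have hE1 : |I - M₁ * (((X₂ : ℝ) - X₁) / L)| ≤ δ / 8 * (x / L) := by
    refine hint.trans ?_
    have h1 : ((X₂ : ℝ) - X₁) / L ≤ 2 * (x / L) := by
      rw [mul_div_assoc']
      refine div_le_div_of_nonneg_right ?_ hlog.le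
      rw [abs_le] at hdiff; linarith only [hdiff.2, hx4]
    have h0 : 0 ≤ ((X₂ : ℝ) - X₁) / L := div_nonneg (by
      have : (X₁ : ℝ) ≤ X₂ := by exact_mod_cast hX₁₂
      linarith only [this]) hlog.le
    calc δ / 16 * (((X₂ : ℝ) - X₁) / L) ≤ δ / 16 * (2 * (x / L)) := mul_le_mul_of_nonneg_left h1 (by positivity)
      _ = δ / 8 * (x / L) := by ring
  have hE2 : |M₁ * (((X₂ : ℝ) - X₁) / L - x / L)| ≤ δ / 8 * (x / L) := by
    have hW : |((X₂ : ℝ) - X₁) / L - x / L| ≤ 2 / L := by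
      rw [← sub_div, abs_div, abs_of_pos hlog]
      exact div_le_div_of_nonneg_right hdiff hlog.le
    rw [abs_mul]
    calc |M₁| * |((X₂ : ℝ) - X₁) / L - x / L| ≤ |M₁| * (2 / L) := mul_le_mul_of_nonneg_left hW (abs_nonneg _)
      _ = (2 * |M₁|) / L := by ring
      _ ≤ (δ / 8 * x) / L := by
          refine div_le_div_of_nonneg_right ?_ hlog.le
          have : 16 * (|M₁| + 1) / δ ≤ x := hxM
          rw [div_le_iff₀ hδ] at this
          nlinarith only [abs_nonneg M₁, this, hδ]
      _ = δ / 8 * (x / L) := by ring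
  have hE3 : |(Nat.factorial (n + 1) : ℝ)⁻¹ * (Sall - (Nat.factorial (n + 1) : ℝ) * I)| ≤ δ / 4 * (x / L) := by
    have hf1 : (Nat.factorial (n + 1) : ℝ)⁻¹ ≤ 1 := by
      rw [inv_le_one₀ (by positivity)]; exact_mod_cast Nat.one_le_iff_ne_zero.2 (Nat.factorial_ne_zero _)
    have hlogX₂ : L ≤ Real.log X₂ := Real.log_le_log hx0 hxX₂
    have hLX : 0 < Real.log (X₂ : ℝ) := lt_of_lt_of_le hlog hlogX₂
    rw [abs_mul, abs_of_nonneg (by positivity)]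
    calc (Nat.factorial (n + 1) : ℝ)⁻¹ * |Sall - (Nat.factorial (n + 1) : ℝ) * I|
        ≤ 1 * (C * (K + MG) * X₂ / Real.log X₂ ^ (2 : ℕ)) := mul_le_mul hf1 htool_x (abs_nonneg _) zero_le_one
      _ ≤ 1 * (C * (K + MG) * (3 * x) / L ^ (2 : ℕ)) := by
          refine mul_le_mul_of_nonneg_left ?_ zero_le_one
          exact div_le_div₀ (by positivity) (mul_le_mul_of_nonneg_left hX₂3 (mul_nonneg hC0 (add_nonneg hK0 hMG0)))
            (by positivity) (pow_le_pow_left₀ hlog.le hlogX₂ 2)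
      _ = (C * (K + MG) * 3 / L) * (x / L) := by field_simp
      _ ≤ δ / 4 * (x / L) := by
          refine mul_le_mul_of_nonneg_right ?_ hxL.le
          rw [div_le_iff₀ hlog]
          have h16 : 16 * (C * (K + MG) * 3 + 1) / δ ≤ L := hlog2
          rw [div_le_iff₀ hδ] at h16
          have hCK : 0 ≤ C * (K + MG) := mul_nonneg hC0 (add_nonneg hK0 hMG0)
          nlinarith only [h16, hCK, hδ, hlog]
  have hE4 : |(Nat.factorial (n + 1) : ℝ)⁻¹ * Snon| ≤ δ / 4 * (x / L) := by
    have hf1 : (Nat.factorial (n + 1) : ℝ)⁻¹ ≤ 1 := by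
      rw [inv_le_one₀ (by positivity)]; exact_mod_cast Nat.one_le_iff_ne_zero.2 (Nat.factorial_ne_zero _)
    have hfl : x ^ ε / 2 ≤ ⌊x ^ ε⌋₊ := by
      have := Nat.lt_floor_add_one (x ^ ε); linarith
    have hxε0 : 0 < x ^ ε := by positivity
    rw [abs_mul, abs_of_nonneg (by positivity)]
    calc (Nat.factorial (n + 1) : ℝ)⁻¹ * |Snon| ≤ 1 * (MG * ((n + 1 : ℝ) ^ (n + 1) * ((X₂ : ℝ) / ⌊x ^ ε⌋₊))) :=
          mul_le_mul hf1 hnon (abs_nonneg _) zero_le_one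
      _ ≤ 1 * (MG * ((n + 1 : ℝ) ^ (n + 1) * (3 * x / (x ^ ε / 2)))) := by
          refine mul_le_mul_of_nonneg_left (mul_le_mul_of_nonneg_left (mul_le_mul_of_nonneg_left ?_ (by positivity)) hMG0) zero_le_one
          exact div_le_div₀ (by positivity) hX₂3 (by positivity) hfl
      _ = (6 * (MG * (n + 1 : ℝ) ^ (n + 1))) * x / x ^ ε := by field_simp; ring
      _ ≤ δ / 4 * (x / L) := by
          set Q : ℝ := MG * (n + 1 : ℝ) ^ (n + 1) with hQ
          have hQ0 : 0 ≤ Q := by positivity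
          have hq : L ≤ δ / (24 * Q + 1) * x ^ ε := hpowε
          have h24 : (24 * Q + 1) * L ≤ δ * x ^ ε := by
            rw [div_mul_eq_mul_div, le_div_iff₀ (by positivity)] at hq
            linarith only [hq]
          rw [div_le_iff₀ hxε0]
          calc 6 * Q * x = (24 * Q * L) * x / (4 * L) := by field_simp; ring
            _ ≤ (δ * x ^ ε) * x / (4 * L) := by
                refine div_le_div_of_nonneg_right (mul_le_mul_of_nonneg_right ?_ hx0.le) (by positivity)
                nlinarith only [h24, hQ0, hlog]
            _ = δ / 4 * (x / L) * x ^ ε := by field_simp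
  calc |I - M₁ * (((X₂ : ℝ) - X₁) / L) + M₁ * (((X₂ : ℝ) - X₁) / L - x / L) +
        (Nat.factorial (n + 1) : ℝ)⁻¹ * (Sall - (Nat.factorial (n + 1) : ℝ) * I) - (Nat.factorial (n + 1) : ℝ)⁻¹ * Snon|
      ≤ |I - M₁ * (((X₂ : ℝ) - X₁) / L)| + |M₁ * (((X₂ : ℝ) - X₁) / L - x / L)| +
        |(Nat.factorial (n + 1) : ℝ)⁻¹ * (Sall - (Nat.factorial (n + 1) : ℝ) * I)| + |(Nat.factorial (n + 1) : ℝ)⁻¹ * Snon| := by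
        refine (abs_sub _ _).trans (add_le_add ((abs_add_le _ _).trans (add_le_add (abs_add_le _ _) le_rfl)) le_rfl)
    _ ≤ δ / 8 * (x / L) + δ / 8 * (x / L) + δ / 4 * (x / L) + δ / 4 * (x / L) := by gcongr
    _ ≤ δ * (x / L) := by nlinarith only [hδ, hxL]

end PerOrder

/-! ### The diagonal truncated inner sum -/

section Diagonal

variable {F : ℝ → ℝ} {D M : ℝ}

/-- `Σ_{1 ≤ r ≤ R} f r = Σ_{s < R} f (s+1)`. [folklore] -/
theorem sum_Icc_one_eq_sum_range (f : ℕ → ℝ) (R : ℕ) :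
    ∑ r ∈ Finset.Icc 1 R, f r = ∑ s ∈ Finset.range R, f (s + 1) := by
  induction R with
  | zero => simp
  | succ R ih => rw [Finset.sum_Icc_succ_top (by omega), ih, Finset.sum_range_succ]

/-- **The diagonal truncated inner sum**: for nice `F` with `|F| ≤ M`, `0 < ε ≤ 1/2`,
`Σ_{X₁ < m ≤ X₂} λ_F(m)² 1_{p(m) > x^ε} = (Σ_{n ≤ 1/ε} Mfun ε n 1 F + o(1)) x/log x`. [cite: Polymath8b2014, §4.5, p. 18, (cpeps)] -/
theorem innerTotal_wTrunc_diag_isLittleO (hF : NiceFun F D) (hMF : ∀ t, |F t| ≤ M) {ε : ℝ} (hε : 0 < ε) (hε1 : ε ≤ 1 / 2)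
    (h₀ : ℤ) :
    (fun x : ℝ => innerTotal (wTrunc F F ε x) (thetaX1 h₀ x) (thetaX2 h₀ x) -
        (∑ n ∈ Finset.range (⌊1 / ε⌋₊ + 1), Mfun ε n 1 F) * (x / Real.log x)) =o[atTop] fun x : ℝ => x / Real.log x := by
  set R₀ := ⌊1 / ε⌋₊ + 1 with hR₀
  have hM0 : 0 ≤ M := (abs_nonneg _).trans (hMF 0)
  -- the decomposition, eventually
  have hmain : (fun x : ℝ => ∑ n ∈ Finset.range R₀,
        (∑ m ∈ roughSqfree (thetaX1 h₀ x) (thetaX2 h₀ x) (x ^ ε) (n + 1), divisorSumWeight F x m ^ 2 - Mfun ε n 1 F * (x / Real.log x)) +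
      ∑ m ∈ roughNonSqfree (thetaX1 h₀ x) (thetaX2 h₀ x) (x ^ ε), divisorSumWeight F x m ^ 2) =o[atTop]
      fun x : ℝ => x / Real.log x := by
    refine IsLittleO.add (IsLittleO.sum fun n _ => sum_roughSqfree_isLittleO hF hε hε1 h₀ n) ?_
    -- the non-square-free part is `O(x^{1-ε})`
    rw [Asymptotics.isLittleO_iff]
    intro δ hδ
    have e_pow : ∀ᶠ x : ℝ in atTop, Real.log x ≤ δ / (6 * (4 ^ R₀ * M ^ 2) + 1) * x ^ ε := by
      have h := (isLittleO_log_rpow_atTop hε).def (show 0 < δ / (6 * (4 ^ R₀ * M ^ 2) + 1) by positivity)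
      filter_upwards [h, eventually_ge_atTop (1 : ℝ)] with x hx hx1
      rwa [Real.norm_of_nonneg (Real.log_nonneg hx1), Real.norm_of_nonneg (Real.rpow_nonneg (by linarith) _)] at hx
    filter_upwards [eventually_window h₀ hε, e_pow] with x hwin hpow
    obtain ⟨hX₁1, -, -, -, hX₂3, -, -, -, hx4, hxε3⟩ := hwin
    have hx0 : 0 < x := by linarith only [hx4]
    have hlog : 0 < Real.log x := Real.log_pos (by linarith only [hx4])
    have hxε0 : 0 < x ^ ε := by positivity
    rw [Real.norm_eq_abs, Real.norm_of_nonneg (div_nonneg hx0.le hlog.le)]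
    refine (abs_sum_roughNonSqfree_le hMF hε hx4 hxε3 hX₂3).trans ?_
    have hfl : x ^ ε / 2 ≤ ⌊x ^ ε⌋₊ := by have := Nat.lt_floor_add_one (x ^ ε); linarith
    set Q : ℝ := 4 ^ R₀ * M ^ 2 with hQ
    have hQ0 : 0 ≤ Q := by positivity
    have h6 : (6 * Q + 1) * Real.log x ≤ δ * x ^ ε := by
      rw [div_mul_eq_mul_div, le_div_iff₀ (by positivity)] at hpow; linarith only [hpow]
    calc Q * ((thetaX2 h₀ x : ℝ) / ⌊x ^ ε⌋₊) ≤ Q * (3 * x / (x ^ ε / 2)) :=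
          mul_le_mul_of_nonneg_left (div_le_div₀ (by positivity) hX₂3 (by positivity) hfl) hQ0
      _ = (6 * Q * Real.log x) * x / (x ^ ε * Real.log x) := by field_simp; ring
      _ ≤ (δ * x ^ ε) * x / (x ^ ε * Real.log x) := by
          refine div_le_div_of_nonneg_right (mul_le_mul_of_nonneg_right ?_ hx0.le) (by positivity)
          nlinarith only [h6, hQ0, hlog]
      _ = δ * (x / Real.log x) := by field_simp
  refine hmain.congr' ?_ (Eventually.of_forall fun _ => rfl)
  filter_upwards [eventually_window h₀ hε] with x hwin
  obtain ⟨hX₁1, -, -, -, hX₂3, -, -, -, hx4, hxε3⟩ := hwin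
  rw [innerTotal_wTrunc_diag_eq F hε hx4 hxε3 hX₁1 hX₂3, sum_Icc_one_eq_sum_range, Finset.sum_sub_distrib, Finset.sum_mul]
  ring

end Diagonal

/-! ### Polarisation: the truncated inner sum of `λ_F λ_G` -/

section Polar

variable {F G : ℝ → ℝ} {D E M : ℝ}

/-- `λ_{F+G} = λ_F + λ_G`. [folklore] -/
theorem divisorSumWeight_add (F G : ℝ → ℝ) (x : ℝ) (n : ℕ) :
    divisorSumWeight (F + G) x n = divisorSumWeight F x n + divisorSumWeight G x n := by
  simp only [divisorSumWeight, Pi.add_apply, mul_add, Finset.sum_add_distrib]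

/-- `λ_{F-G} = λ_F - λ_G`. [folklore] -/
theorem divisorSumWeight_sub (F G : ℝ → ℝ) (x : ℝ) (n : ℕ) :
    divisorSumWeight (F - G) x n = divisorSumWeight F x n - divisorSumWeight G x n := by
  simp only [divisorSumWeight, Pi.sub_apply, mul_sub, Finset.sum_sub_distrib]

/-- Polarisation of the truncated sequence. [folklore] -/
theorem wTrunc_polar (F G : ℝ → ℝ) (ε x : ℝ) (m : ℕ) :
    wTrunc F G ε x m = (wTrunc (F + G) (F + G) ε x m - wTrunc (F - G) (F - G) ε x m) / 4 := by
  simp only [wTrunc, divisorSumWeight_add, divisorSumWeight_sub]; ring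

/-- **The truncated inner sum (cpeps)**: for nice `F, G` with `|F|, |G| ≤ M` and `0 < ε ≤ 1/2`,
`Σ_{X₁ < m ≤ X₂} λ_F(m) λ_G(m) 1_{p(m) > x^ε} = (c''_ε(F,G) + o(1)) x/log x` with
`c''_ε(F,G) = Depol.cdeps ε (⌊1/ε⌋+1) F G`. [cite: Polymath8b2014, §4.5, p. 18, (cpeps)] -/
theorem innerTotal_wTrunc_isLittleO (hF : NiceFun F D) (hG : NiceFun G E) (hMF : ∀ t, |F t| ≤ M) (hMG : ∀ t, |G t| ≤ M)
    {ε : ℝ} (hε : 0 < ε) (hε1 : ε ≤ 1 / 2) (h₀ : ℤ) :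
    (fun x : ℝ => innerTotal (wTrunc F G ε x) (thetaX1 h₀ x) (thetaX2 h₀ x) -
        cdeps ε (⌊1 / ε⌋₊ + 1) F G * (x / Real.log x)) =o[atTop] fun x : ℝ => x / Real.log x := by
  have h1 := innerTotal_wTrunc_diag_isLittleO (hF.add hG) (M := M + M)
    (fun t => by rw [Pi.add_apply]; exact (abs_add_le _ _).trans (add_le_add (hMF t) (hMG t))) hε hε1 h₀
  have h2 := innerTotal_wTrunc_diag_isLittleO (hF.sub hG) (M := M + M)
    (fun t => by rw [Pi.sub_apply]; exact (abs_sub _ _).trans (add_le_add (hMF t) (hMG t))) hε hε1 h₀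
  have h := (h1.sub h2).const_mul_left (1 / 4)
  refine h.congr' (Eventually.of_forall fun x => ?_) (Eventually.of_forall fun _ => rfl)
  simp only [innerTotal, cdeps]
  rw [Finset.sum_congr rfl fun m _ => wTrunc_polar F G ε x m, ← Finset.sum_div, Finset.sum_sub_distrib]
  ring

end Polar

end RoughMain

end Literature.NumberTheory.Sieve
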